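import Literature.NumberTheory.Rogawski1990.ArchExplicitTransferFactorAtlasGeneral    -- ★ LH3-p04 (g2) (I₁-Δ-S) PART 2b: `archExplicitDelta_atlas_eq_mul` (Δ″ = K^S_ρ·τ·D on the general chart)
import Literature.NumberTheory.Rogawski1990.ArchCanonicalTransferFactor                -- ★ `archMajoritySign_mul_self`
import HarnessLib

/-!
# (Δ-mirror-S), general chart: `Δ″(endoTorus S c, gprimeTorus α S (c∘ρ°)) = ± Δ″(endoTorus S c, gprimeTorus α S (c∘ρ))` EXACTLY at every compact place, signs from the κ-table
# (Rogawski 1990 §4.9 p. 55, §14.6 p. 242; Langlands–Shelstad 1987 §2.4; Shelstad 1979 §4)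

Topic `NumberTheory/Rogawski1990`; namespace `Literature.NumberTheory.Rogawski1990`.  THEOREMS ONLY (no `def`, no instance, no notation, no axiom, no named fact, no `sorry`).
Cell `pub/hodgecm-mathlib`, line LH3 (closer stub `stub_N9`, crux H413 = `stmt-HodgeConjecture-24833`), DIRECT ROAD organ **(Δ-mirror-S)** = the general-chart twin of ★ p849739 `ArchExplicitTransferFactorMirror` (compact chart): on the Cartan atlas chart `S ⊆ splitChartPlaces`
(`H`-point `endoTorus S c`, partners `gprimeTorus α S (c∘ρ)` with `ρ_w = 1` on `S`, slot-to-line maps `τ_w = lineOf (formSign L α w)`) the explicit factor of ★ (I₁-Δ-S) PART 2b is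
`Δ″ = K^S_ρ · (τ·D_{G∕H})(endoTorus S c)` with `(τ·D)` INDEPENDENT OF THE PARTNER and `K^S_ρ = Π_w sgn(re σ_w α_{τ_w(ρ_w⁻¹ 1)})·η_w ∈ {±1}` (`α_i ≠ 0` hermitian).  Hence for ANY two partners `Δ″_{ρ′} = (K^S_{ρ′}K^S_ρ)·Δ″_ρ` as an identity of functions of `c` (ALL `c`), and for the MIRROR partner `ρ° = update ρ w ((i j)·ρ_w)` at a COMPACT
place `w ∉ S` across the wall `c_w i ≡ c_w j` the sign `K^S_{ρ°}K^S_ρ` is (with `τ = τ_w`, lines `τ(ρ_w⁻¹ k)` carrying `e^{i c_w k}`): `−1` across a `G`-wall (`k = 1` against `k = 0`, or against `k = 2`) whose two LINES `τ(ρ_w⁻¹ 1), τ(ρ_w⁻¹ 0)` (resp. `τ(ρ_w⁻¹ 1), τ(ρ_w⁻¹ 2)`) have OPPOSITE form signs, `+1` when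
they have the same sign, and ALWAYS `+1` across the `H`-wall (`k = 0` against `k = 2`: the 1-block slot does not move) — the κ-TABLE of D2′-SPEC §3 on every chart, as exact identities;
the split places `w ∈ S` carry one partner class and are untouched (`ρ° = ρ` there).

WHAT IS PROVED (`K^S_ρ` spelled out as the product above).
* `atlasSignProd_mul_self` — `K^S_ρ · K^S_ρ = 1`;  `archExplicitDelta_atlas_relabel_eq_sign_mul_relabel` — `Δ″(endoTorus S c, gprimeTorus α S (c∘ρ′)) = (K^S_{ρ′}K^S_ρ) · Δ″(…(c∘ρ))`;
* `atlasSignProd_update_mul` — `K^S_{update ρ w (π·ρ_w)} · K^S_ρ = sgn(re σ_w α_{τ_w(ρ_w⁻¹(π⁻¹ 1))}) · sgn(re σ_w α_{τ_w(ρ_w⁻¹ 1)})` (only the `w`-factor moves);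
* the three walls at a compact place `w ∉ S`: `archExplicitDelta_atlas_mirror01_of_neg ∕ _of_pos`, `…mirror12_of_neg ∕ _of_pos`, `…mirror02` (always `+`).
HONEST LABEL: HC_CM is proved only modulo the 7 printed citations (2 remaining: hLiu418 = stmt-HodgeConjecture-24832, h413 = stmt-HodgeConjecture-24833) until rung 0 closes; this organ feeds
(M2-indef)∕(M3) of `stub_N9`'s L2 on every chart and pays nothing by itself.

## References
* [Rogawski1990] J. D. Rogawski, *Automorphic Representations of Unitary Groups in Three Variables*, Ann. of Math. Stud. 123 (1990), §4.9 p. 55, §14.6 p. 242, §8.2 pp. 122–124.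
* [LanglandsShelstad1987] R. P. Langlands, D. Shelstad, *On the definition of transfer factors*, Math. Ann. 278 (1987), §2.4.
* [Shelstad1979] D. Shelstad, *Characters and inner forms of a quasi-split group over ℝ*, Compositio Math. 39 (1979), §4.
-/

set_option autoImplicit false

noncomputable section

open NumberField NumberField.InfinitePlace Equiv
open scoped MatrixGroups ComplexConjugate Classical
open Literature.NumberTheory.Automorphic Literature.NumberTheory.Automorphic.UnitaryGroup Literature.NumberTheory.GaloisRepresentations

namespace Literature.NumberTheory.Rogawski1990

section Mirror

variable (L : Type) [Field L] [NumberField L] [IsCMField L] (α : Fin 3 → L)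
  (μ : HeckeCharacter L) (S : Finset {w : InfinitePlace L // IsComplex w}) (c : {w : InfinitePlace L // IsComplex w} → Fin 3 → ℝ)

/-- `sgn(x)·sgn(x) = 1` for `x ≠ 0` (in `ℤ`). [folklore] -/
private theorem sign_intCast_mul_self' {x : ℝ} (hx : x ≠ 0) : (SignType.sign x : ℤ) * (SignType.sign x : ℤ) = 1 := by
  rcases lt_or_gt_of_ne hx with h | h
  · rw [sign_neg h]; simp
  · rw [sign_pos h]; simp

/-- **`K^S_ρ · K^S_ρ = 1`**: every factor `sgn(re σ_w α_{τ_w(ρ_w⁻¹ 1)})·η_w` of the κ-sign product is `±1` (`α_i ≠ 0` hermitian ⇒ `re σ_w α_i ≠ 0`; ★ `archMajoritySign_mul_self`).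
[cite: Rogawski1990, §14.6 p. 242] -/
theorem atlasSignProd_mul_self (hα : ∀ i, α i ≠ 0) (hherm : ∀ i, (IsCMField.complexConj L (α i) : L) = α i)
    (ρ : {w : InfinitePlace L // IsComplex w} → Perm (Fin 3)) :
    (∏ w : {w : InfinitePlace L // IsComplex w}, ((SignType.sign ((w.1.embedding (α (lineOf (formSign L α w) ((ρ w).symm 1)))).re) : ℤ) * archMajoritySign L (Matrix.diagonal α) w)) *
      (∏ w : {w : InfinitePlace L // IsComplex w}, ((SignType.sign ((w.1.embedding (α (lineOf (formSign L α w) ((ρ w).symm 1)))).re) : ℤ) * archMajoritySign L (Matrix.diagonal α) w)) = 1 := by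
  rw [← Finset.prod_mul_distrib]
  refine Finset.prod_eq_one fun w _ => ?_
  have hre : (w.1.embedding (α (lineOf (formSign L α w) ((ρ w).symm 1)))).re ≠ 0 := fun h =>
    hα _ (w.1.embedding.injective (by rw [map_zero]; exact Complex.ext h (UnitaryGroup.im_embedding_eq_zero_of_complexConj_eq L w (hherm _))))
  have hs := sign_intCast_mul_self' hre
  have hη := archMajoritySign_mul_self L (Matrix.diagonal α) w
  linear_combination (archMajoritySign L (Matrix.diagonal α) w * archMajoritySign L (Matrix.diagonal α) w) * hs + hη

/-- **(Δ-mirror), GENERAL FORM: `Δ″(endoTorus S c, gprimeTorus α S (c∘ρ′)) = (K^S_{ρ′}·K^S_ρ) · Δ″(endoTorus S c, gprimeTorus α S (c∘ρ))` FOR ALL `c`** — two partners of the same `H`-point differ by the constant sign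
`K^S_{ρ′}K^S_ρ ∈ {±1}` (★ PART 2b: `Δ″_ρ = K^S_ρ·(τ·D)` with `τ·D` partner-free; `(K^S_ρ)² = 1`). [cite: Rogawski1990, §4.9 p. 55; §14.6 p. 242] [cite: LanglandsShelstad1987, §2.4] -/
theorem archExplicitDelta_atlas_relabel_eq_sign_mul_relabel (hα : ∀ i, α i ≠ 0) (hherm : ∀ i, (IsCMField.complexConj L (α i) : L) = α i)
    (hS : ∀ w ∈ S, w ∈ splitChartPlaces L α) (ρ ρ' : {w : InfinitePlace L // IsComplex w} → Perm (Fin 3)) (hρ : ∀ w ∈ S, ρ w = 1) (hρ' : ∀ w ∈ S, ρ' w = 1) :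
    archExplicitDelta L (Matrix.diagonal α) (endoTorus L S c) μ (gprimeTorus L α S fun v => c v ∘ ⇑(ρ' v)) =
      (((∏ w : {w : InfinitePlace L // IsComplex w}, ((SignType.sign ((w.1.embedding (α (lineOf (formSign L α w) ((ρ' w).symm 1)))).re) : ℤ) * archMajoritySign L (Matrix.diagonal α) w)) *
          (∏ w : {w : InfinitePlace L // IsComplex w}, ((SignType.sign ((w.1.embedding (α (lineOf (formSign L α w) ((ρ w).symm 1)))).re) : ℤ) * archMajoritySign L (Matrix.diagonal α) w)) : ℤ) : ℂ) *
        archExplicitDelta L (Matrix.diagonal α) (endoTorus L S c) μ (gprimeTorus L α S fun v => c v ∘ ⇑(ρ v)) := by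
  rw [archExplicitDelta_atlas_eq_mul L α μ c hS ρ' hρ', archExplicitDelta_atlas_eq_mul L α μ c hS ρ hρ]
  have h1 := atlasSignProd_mul_self L α hα hherm ρ
  set Kρ : ℤ := ∏ w : {w : InfinitePlace L // IsComplex w}, ((SignType.sign ((w.1.embedding (α (lineOf (formSign L α w) ((ρ w).symm 1)))).re) : ℤ) * archMajoritySign L (Matrix.diagonal α) w)
  set Kρ' : ℤ := ∏ w : {w : InfinitePlace L // IsComplex w}, ((SignType.sign ((w.1.embedding (α (lineOf (formSign L α w) ((ρ' w).symm 1)))).re) : ℤ) * archMajoritySign L (Matrix.diagonal α) w)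
  calc (Kρ' : ℂ) * (archTau L (endoTorus L S c) μ * (archWeylRatio L (endoTorus L S c) : ℂ))
      = ((Kρ' * (Kρ * Kρ) : ℤ) : ℂ) * (archTau L (endoTorus L S c) μ * (archWeylRatio L (endoTorus L S c) : ℂ)) := by rw [h1, mul_one]
    _ = ((Kρ' * Kρ : ℤ) : ℂ) * ((Kρ : ℂ) * (archTau L (endoTorus L S c) μ * (archWeylRatio L (endoTorus L S c) : ℂ))) := by push_cast; ring

/-- **ONLY THE `w`-FACTOR MOVES**: for `ρ° = update ρ w (π·ρ_w)`, `K^S_{ρ°}·K^S_ρ = sgn(re σ_w α_{τ_w(ρ_w⁻¹(π⁻¹ 1))}) · sgn(re σ_w α_{τ_w(ρ_w⁻¹ 1)})` (the `v ≠ w` factors square to `1`,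
`η_w² = 1`). [cite: Rogawski1990, §14.6 p. 242] -/
theorem atlasSignProd_update_mul (hα : ∀ i, α i ≠ 0) (hherm : ∀ i, (IsCMField.complexConj L (α i) : L) = α i)
    (ρ : {w : InfinitePlace L // IsComplex w} → Perm (Fin 3)) (w : {w : InfinitePlace L // IsComplex w}) (π : Perm (Fin 3)) :
    (∏ v : {w : InfinitePlace L // IsComplex w}, ((SignType.sign ((v.1.embedding (α (lineOf (formSign L α v) ((Function.update ρ w (π * ρ w) v).symm 1)))).re) : ℤ) * archMajoritySign L (Matrix.diagonal α) v)) *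
      (∏ v : {w : InfinitePlace L // IsComplex w}, ((SignType.sign ((v.1.embedding (α (lineOf (formSign L α v) ((ρ v).symm 1)))).re) : ℤ) * archMajoritySign L (Matrix.diagonal α) v)) =
      (SignType.sign ((w.1.embedding (α (lineOf (formSign L α w) ((ρ w).symm (π.symm 1))))).re) : ℤ) * (SignType.sign ((w.1.embedding (α (lineOf (formSign L α w) ((ρ w).symm 1)))).re) : ℤ) := by
  have hre : ∀ i, (w.1.embedding (α i)).re ≠ 0 := fun i h =>
    hα _ (w.1.embedding.injective (by rw [map_zero]; exact Complex.ext h (UnitaryGroup.im_embedding_eq_zero_of_complexConj_eq L w (hherm _))))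
  rw [← Finset.mul_prod_erase Finset.univ _ (Finset.mem_univ w), ← Finset.mul_prod_erase Finset.univ _ (Finset.mem_univ w), Function.update_self,
    Finset.prod_congr rfl fun v hv => by rw [Function.update_of_ne (Finset.ne_of_mem_erase hv)]]
  have hrest := atlasSignProd_mul_self L α hα hherm ρ
  rw [← Finset.mul_prod_erase Finset.univ _ (Finset.mem_univ w)] at hrest
  set R : ℤ := ∏ v ∈ Finset.univ.erase w, ((SignType.sign ((v.1.embedding (α (lineOf (formSign L α v) ((ρ v).symm 1)))).re) : ℤ) * archMajoritySign L (Matrix.diagonal α) v) with hR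
  have hπ : (π * ρ w).symm 1 = (ρ w).symm (π.symm 1) := by simp [Equiv.Perm.mul_def]
  rw [hπ]
  have hs := sign_intCast_mul_self' (hre (lineOf (formSign L α w) ((ρ w).symm 1)))
  linear_combination ((SignType.sign ((w.1.embedding (α (lineOf (formSign L α w) ((ρ w).symm (π.symm 1))))).re) : ℤ) * (SignType.sign ((w.1.embedding (α (lineOf (formSign L α w) ((ρ w).symm 1)))).re) : ℤ)) * hrest -
    ((SignType.sign ((w.1.embedding (α (lineOf (formSign L α w) ((ρ w).symm (π.symm 1))))).re) : ℤ) * (SignType.sign ((w.1.embedding (α (lineOf (formSign L α w) ((ρ w).symm 1)))).re) : ℤ) *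
      archMajoritySign L (Matrix.diagonal α) w ^ 2 * R ^ 2) * hs

/-- `sgn(a)·sgn(b) = −1` when `ab < 0`, `= 1` when `0 < ab`. [folklore] -/
private theorem sign_mul_sign_of_mul_neg' {a b : ℝ} (h : a * b < 0) : (SignType.sign a : ℤ) * (SignType.sign b : ℤ) = -1 := by
  rcases mul_neg_iff.mp h with ⟨ha, hb⟩ | ⟨ha, hb⟩
  · rw [sign_pos ha, sign_neg hb]; simp
  · rw [sign_neg ha, sign_pos hb]; simp

/-- `sgn(a)·sgn(b) = 1` when `0 < ab`. [folklore] -/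
private theorem sign_mul_sign_of_mul_pos' {a b : ℝ} (h : 0 < a * b) : (SignType.sign a : ℤ) * (SignType.sign b : ℤ) = 1 := by
  rcases mul_pos_iff.mp h with ⟨ha, hb⟩ | ⟨ha, hb⟩
  · rw [sign_pos ha, sign_pos hb]; simp
  · rw [sign_neg ha, sign_neg hb]; simp

/-- **(Δ-mirror-S) ACROSS THE `G`-WALL `c₁ ≡ c₀` AT A COMPACT PLACE `w ∉ S`, NONCOMPACT WALL**: the mirror partner `ρ° = update ρ w ((0 1)·ρ_w)` (the lines of `e^{ic_{w,0}}` and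
`e^{ic_{w,1}}` exchanged) has `Δ″(endoTorus S c, gprimeTorus α S (c∘ρ°)) = −Δ″(endoTorus S c, gprimeTorus α S (c∘ρ))` for ALL `c` when those two lines have opposite form signs. [cite: Rogawski1990, §14.6 p. 242; §8.2 p. 123] [cite: Shelstad1979, §4] -/
theorem archExplicitDelta_atlas_mirror01_of_neg (hα : ∀ i, α i ≠ 0) (hherm : ∀ i, (IsCMField.complexConj L (α i) : L) = α i)
    (hS : ∀ w ∈ S, w ∈ splitChartPlaces L α) (ρ : {w : InfinitePlace L // IsComplex w} → Perm (Fin 3)) (hρ : ∀ w ∈ S, ρ w = 1)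
    (w : {w : InfinitePlace L // IsComplex w}) (hw : w ∉ S)
    (hnc : (w.1.embedding (α (lineOf (formSign L α w) ((ρ w).symm 0)))).re * (w.1.embedding (α (lineOf (formSign L α w) ((ρ w).symm 1)))).re < 0) :
    archExplicitDelta L (Matrix.diagonal α) (endoTorus L S c) μ (gprimeTorus L α S fun v => c v ∘ ⇑(Function.update ρ w (Equiv.swap (0 : Fin 3) 1 * ρ w) v)) =
      -archExplicitDelta L (Matrix.diagonal α) (endoTorus L S c) μ (gprimeTorus L α S fun v => c v ∘ ⇑(ρ v)) := by
  have hρ' : ∀ v ∈ S, Function.update ρ w (Equiv.swap (0 : Fin 3) 1 * ρ w) v = 1 := fun v hv => by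
    rw [Function.update_of_ne (fun h : v = w => hw (h ▸ hv)), hρ v hv]
  rw [archExplicitDelta_atlas_relabel_eq_sign_mul_relabel L α μ S c hα hherm hS ρ _ hρ hρ', atlasSignProd_update_mul L α hα hherm ρ w,
    show (Equiv.swap (0 : Fin 3) 1).symm 1 = 0 by simp [Equiv.swap_apply_right], sign_mul_sign_of_mul_neg' hnc]
  simp

/-- (Δ-mirror-S) across the `G`-wall `c₁ ≡ c₀` at `w ∉ S`, COMPACT WALL: `Δ″_{ρ°} = Δ″_ρ` when the two lines have the same form sign. [cite: Rogawski1990, §14.6 p. 242] -/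
theorem archExplicitDelta_atlas_mirror01_of_pos (hα : ∀ i, α i ≠ 0) (hherm : ∀ i, (IsCMField.complexConj L (α i) : L) = α i)
    (hS : ∀ w ∈ S, w ∈ splitChartPlaces L α) (ρ : {w : InfinitePlace L // IsComplex w} → Perm (Fin 3)) (hρ : ∀ w ∈ S, ρ w = 1)
    (w : {w : InfinitePlace L // IsComplex w}) (hw : w ∉ S)
    (hpos : 0 < (w.1.embedding (α (lineOf (formSign L α w) ((ρ w).symm 0)))).re * (w.1.embedding (α (lineOf (formSign L α w) ((ρ w).symm 1)))).re) :
    archExplicitDelta L (Matrix.diagonal α) (endoTorus L S c) μ (gprimeTorus L α S fun v => c v ∘ ⇑(Function.update ρ w (Equiv.swap (0 : Fin 3) 1 * ρ w) v)) =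
      archExplicitDelta L (Matrix.diagonal α) (endoTorus L S c) μ (gprimeTorus L α S fun v => c v ∘ ⇑(ρ v)) := by
  have hρ' : ∀ v ∈ S, Function.update ρ w (Equiv.swap (0 : Fin 3) 1 * ρ w) v = 1 := fun v hv => by
    rw [Function.update_of_ne (fun h : v = w => hw (h ▸ hv)), hρ v hv]
  rw [archExplicitDelta_atlas_relabel_eq_sign_mul_relabel L α μ S c hα hherm hS ρ _ hρ hρ', atlasSignProd_update_mul L α hα hherm ρ w,
    show (Equiv.swap (0 : Fin 3) 1).symm 1 = 0 by simp [Equiv.swap_apply_right], sign_mul_sign_of_mul_pos' hpos]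
  simp

/-- **(Δ-mirror-S) ACROSS THE `G`-WALL `c₁ ≡ c₂` AT `w ∉ S`, NONCOMPACT WALL**: `ρ° = update ρ w ((1 2)·ρ_w)`, opposite signs on the lines of `e^{ic_{w,2}}`, `e^{ic_{w,1}}` ⇒ `Δ″_{ρ°} = −Δ″_ρ` for all `c`.
[cite: Rogawski1990, §14.6 p. 242; §8.2 p. 123] [cite: Shelstad1979, §4] -/
theorem archExplicitDelta_atlas_mirror12_of_neg (hα : ∀ i, α i ≠ 0) (hherm : ∀ i, (IsCMField.complexConj L (α i) : L) = α i)
    (hS : ∀ w ∈ S, w ∈ splitChartPlaces L α) (ρ : {w : InfinitePlace L // IsComplex w} → Perm (Fin 3)) (hρ : ∀ w ∈ S, ρ w = 1)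
    (w : {w : InfinitePlace L // IsComplex w}) (hw : w ∉ S)
    (hnc : (w.1.embedding (α (lineOf (formSign L α w) ((ρ w).symm 2)))).re * (w.1.embedding (α (lineOf (formSign L α w) ((ρ w).symm 1)))).re < 0) :
    archExplicitDelta L (Matrix.diagonal α) (endoTorus L S c) μ (gprimeTorus L α S fun v => c v ∘ ⇑(Function.update ρ w (Equiv.swap (1 : Fin 3) 2 * ρ w) v)) =
      -archExplicitDelta L (Matrix.diagonal α) (endoTorus L S c) μ (gprimeTorus L α S fun v => c v ∘ ⇑(ρ v)) := by
  have hρ' : ∀ v ∈ S, Function.update ρ w (Equiv.swap (1 : Fin 3) 2 * ρ w) v = 1 := fun v hv => by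
    rw [Function.update_of_ne (fun h : v = w => hw (h ▸ hv)), hρ v hv]
  rw [archExplicitDelta_atlas_relabel_eq_sign_mul_relabel L α μ S c hα hherm hS ρ _ hρ hρ', atlasSignProd_update_mul L α hα hherm ρ w,
    show (Equiv.swap (1 : Fin 3) 2).symm 1 = 2 by simp [Equiv.swap_apply_left], sign_mul_sign_of_mul_neg' hnc]
  simp

/-- (Δ-mirror-S) across the `G`-wall `c₁ ≡ c₂` at `w ∉ S`, COMPACT WALL: `Δ″_{ρ°} = Δ″_ρ`. [cite: Rogawski1990, §14.6 p. 242] -/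
theorem archExplicitDelta_atlas_mirror12_of_pos (hα : ∀ i, α i ≠ 0) (hherm : ∀ i, (IsCMField.complexConj L (α i) : L) = α i)
    (hS : ∀ w ∈ S, w ∈ splitChartPlaces L α) (ρ : {w : InfinitePlace L // IsComplex w} → Perm (Fin 3)) (hρ : ∀ w ∈ S, ρ w = 1)
    (w : {w : InfinitePlace L // IsComplex w}) (hw : w ∉ S)
    (hpos : 0 < (w.1.embedding (α (lineOf (formSign L α w) ((ρ w).symm 2)))).re * (w.1.embedding (α (lineOf (formSign L α w) ((ρ w).symm 1)))).re) :
    archExplicitDelta L (Matrix.diagonal α) (endoTorus L S c) μ (gprimeTorus L α S fun v => c v ∘ ⇑(Function.update ρ w (Equiv.swap (1 : Fin 3) 2 * ρ w) v)) =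
      archExplicitDelta L (Matrix.diagonal α) (endoTorus L S c) μ (gprimeTorus L α S fun v => c v ∘ ⇑(ρ v)) := by
  have hρ' : ∀ v ∈ S, Function.update ρ w (Equiv.swap (1 : Fin 3) 2 * ρ w) v = 1 := fun v hv => by
    rw [Function.update_of_ne (fun h : v = w => hw (h ▸ hv)), hρ v hv]
  rw [archExplicitDelta_atlas_relabel_eq_sign_mul_relabel L α μ S c hα hherm hS ρ _ hρ hρ', atlasSignProd_update_mul L α hα hherm ρ w,
    show (Equiv.swap (1 : Fin 3) 2).symm 1 = 2 by simp [Equiv.swap_apply_left], sign_mul_sign_of_mul_pos' hpos]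
  simp

/-- **(Δ-mirror-S) ACROSS THE `H`-WALL `c₀ ≡ c₂` AT `w ∉ S`: ALWAYS `+`** — `ρ° = update ρ w ((0 2)·ρ_w)` keeps the line of the 1-block eigenvalue `e^{ic_{w,1}}`, so `K^S_{ρ°} = K^S_ρ` and
`Δ″_{ρ°} = Δ″_ρ` for all `c` («equal κ across the H-wall»: the jumps ADD, D2′-SPEC §3). [cite: Rogawski1990, §14.6 p. 242; §8.2 p. 124] [cite: Shelstad1979, §4] -/
theorem archExplicitDelta_atlas_mirror02 (hα : ∀ i, α i ≠ 0) (hherm : ∀ i, (IsCMField.complexConj L (α i) : L) = α i)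
    (hS : ∀ w ∈ S, w ∈ splitChartPlaces L α) (ρ : {w : InfinitePlace L // IsComplex w} → Perm (Fin 3)) (hρ : ∀ w ∈ S, ρ w = 1)
    (w : {w : InfinitePlace L // IsComplex w}) (hw : w ∉ S) :
    archExplicitDelta L (Matrix.diagonal α) (endoTorus L S c) μ (gprimeTorus L α S fun v => c v ∘ ⇑(Function.update ρ w (Equiv.swap (0 : Fin 3) 2 * ρ w) v)) =
      archExplicitDelta L (Matrix.diagonal α) (endoTorus L S c) μ (gprimeTorus L α S fun v => c v ∘ ⇑(ρ v)) := by
  have hre : (w.1.embedding (α (lineOf (formSign L α w) ((ρ w).symm 1)))).re ≠ 0 := fun h =>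
    hα _ (w.1.embedding.injective (by rw [map_zero]; exact Complex.ext h (UnitaryGroup.im_embedding_eq_zero_of_complexConj_eq L w (hherm _))))
  have hρ' : ∀ v ∈ S, Function.update ρ w (Equiv.swap (0 : Fin 3) 2 * ρ w) v = 1 := fun v hv => by
    rw [Function.update_of_ne (fun h : v = w => hw (h ▸ hv)), hρ v hv]
  rw [archExplicitDelta_atlas_relabel_eq_sign_mul_relabel L α μ S c hα hherm hS ρ _ hρ hρ', atlasSignProd_update_mul L α hα hherm ρ w,
    show (Equiv.swap (0 : Fin 3) 2).symm 1 = 1 by simp [Equiv.swap_apply_of_ne_of_ne], sign_intCast_mul_self' hre]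
  simp

end Mirror

end Literature.NumberTheory.Rogawski1990

end
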